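import Literature.IUT.LogVolume.TensorPacketHullFieldMonotone
import Literature.IUT.LogVolume.LocalFieldEmbeddings
import Literature.IUT.LogVolume.LocalUnitLogEquivariance
import HarnessLib

/-!
# Base extension of a tensor packet: the content is NON-INCREASING and the (Ind2)-orbit hull volume is
# NON-DECREASING along a packet morphism with SATURATED log-shell preimage ([IUTchIV] Prop. 1.2; G1-Θ item (X))

abc-iut cell, prover seat abc-iut-w5-d036 (gen 5); sequel to `TensorPacketHullFieldMonotone` (item (X) of
abc-iut-w5-d166's `G1-THETA-SHAPES.md` at an UNRAMIFIED small side). HERE the general mechanism behind the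
cross-field comparison of the two Θ-sides (small fields `k_i = F_{w_i}` ↦ big fields `k'_i = K_{v̲_i}`), for an
ARBITRARY `ℚ_p`-algebra homomorphism `φ : V = ⊗_{ℚ_p} k_i → V' = ⊗_{ℚ_p} k'_i` of packets (in the application,
`φ = ⊗_i σ_i` for field embeddings `σ_i : k_i → k'_i`; `φ` enters only through its values on the coprojections,
`φ(ι_i(a)) = ι'_i(σ_i(a))`), under ONE lattice hypothesis — SATURATION of the log-shell lattice,
`φ⁻¹(log_p(R'_I^×)) ⊆ log_p(R_I^×)` (`hsat`; for `φ = ⊗σ_i` at tame tuples this is the statement that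
`⊗_i 𝔪_{k'_i} ∩ φ(V) = φ(⊗_i 𝔪_{k_i})`, a `ℤ_p`-basis bookkeeping NOT proved in this file):

* `map_purePacket_of_iota` / `map_mem_normalizedPacket` — such a `φ` maps pure tensors to pure tensors and the
  integral structure `(R_I)^∼` into `(R'_I)^∼` (`(R_I)^∼` = integral closure of `ℤ_p`, abc-iut-S5's
  `mem_normalizedPacket_iff_isIntegral`); `image_slotUnion_subset` — it maps the slot-union `⋃_i ι_i(g_i)·(R_I)^∼`
  into the slot-union of the images `⋃_i ι'_i(σ_i g_i)·(R'_I)^∼`;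
* **`content_le_content_of_sat`** — under `hsat`, if `φ(U) ⊆ U'` then the content of `U'` w.r.t. `log_p(R'_I^×)` is
  AT MOST the content of `U` w.r.t. `log_p(R_I^×)` (`U ⊆ φ⁻¹(p^{m'}·Λ') ⊆ p^{m'}·Λ`);
* **`packetLogμ_packetHull_orbit_le_add_of_sat`** — hence `log μ̄(hull(⋃_γ γ·U)) ≤ log μ̄'(hull'(⋃_{γ'} γ'·U'))
  + (H − H')`, `H := log μ̄(hull(log_p(R_I^×)))`, `H' := log μ̄'(hull'(log_p(R'_I^×)))` (exact orbit formula
  `−m·log p + H` on both sides, abc-iut-w5-d180);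
* **`packetLogμ_packetHull_logPacket_le_of_algHom`** — `H ≤ H'` as soon as there are `ℚ_p`-algebra maps
  `σ_i : k_i → k'_i` (they are isometries, campaign-S `norm_map_algHom`, and map `log_p(R_i^×)` into `log_p(R'_i^×)`,
  abc-iut-w5-d242's `image_logUnits_subset`; `H = Σ_i log‖z_i^max‖`, abc-iut-w5-d082);
* **`packetLogμ_packetHull_orbit_slotUnion_le_of_sat`** — CONSEQUENTLY, for slot elements `g_i ∈ k_i` and
  `φ` with `φ(ι_i(a)) = ι'_i(σ_i a)`: `log μ̄(hull(⋃_γ γ·⋃_i ι_i(g_i)·(R_I)^∼)) ≤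
  log μ̄'(hull'(⋃_{γ'} γ'·⋃_i ι'_i(σ_i g_i)·(R'_I)^∼))` — item (X) at EVERY prime, reduced to the saturation `hsat`.

HONEST SCOPE. `hsat` is an explicit hypothesis (a statement about `ℤ_p`-lattices in the two packets, true for
`φ = ⊗σ_i` when every `log_p(R'_i^×) ∩ σ_i(k_i) = σ_i(log_p(R_i^×))` and the `log_p(R_i^×)` are free — e.g. at tame
tuples — by a basis argument; NOT proved here, no `Prop` fact introduced); without it the content CAN increase (wild
`k'_i/k_i` with `p ∣ [k'_i : k_i]`). Classical lattice algebra over the tree's typings of (Ind2)/the hull of the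
disputed corpus [claim: Mochizuki2012, status: disputed]; nothing here takes a side on [IUTchIII] Cor. 3.12;
typed ≠ proved. PROOF-ONLY file: no definitions. [cite: Mochizuki2012, IUTchIV Prop. 1.2 (ii) p. 10]
[cite: DupuyHilado2025, §4.9, §4.12] [cite: NeukirchANT1999, Ch. II Thm. (4.8)]
-/

noncomputable section

open Set Module
open scoped Pointwise TensorProduct

namespace Literature.IUT.LogVolume

variable (p : ℕ) [Fact p.Prime]
variable {I : Type} [Fintype I] [DecidableEq I] [Nonempty I]
variable (k : I → Type) [∀ i, NontriviallyNormedField (k i)] [∀ i, NormedAlgebra ℚ_[p] (k i)]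
  [∀ i, IsUltrametricDist (k i)] [∀ i, ProperSpace (k i)]
variable (k' : I → Type) [∀ i, NontriviallyNormedField (k' i)] [∀ i, NormedAlgebra ℚ_[p] (k' i)]
  [∀ i, IsUltrametricDist (k' i)] [∀ i, ProperSpace (k' i)]
variable (φ : PacketAlgebra p k →ₐ[ℚ_[p]] PacketAlgebra p k')

/-! ## §1 A packet morphism given on the coprojections -/

section Coprojections

variable (σ : ∀ i, k i →ₐ[ℚ_[p]] k' i) (hφ : ∀ (i : I) (a : k i), φ (iota p k i a) = iota p k' i (σ i a))
include hφ

omit [Nonempty I] [∀ i, IsUltrametricDist (k i)] [∀ i, ProperSpace (k i)]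
  [∀ i, IsUltrametricDist (k' i)] [∀ i, ProperSpace (k' i)] in
/-- `φ(⊗_i x_i) = ⊗_i σ_i(x_i)` (`⊗ x_i = Π_i ι_i(x_i)`). [cite: Mochizuki2012, IUTchIV Prop. 1.1 p. 9] -/
theorem map_purePacket_of_iota (x : Π i, k i) :
    φ (purePacket p k x) = purePacket p k' (fun i => σ i (x i)) := by
  rw [purePacket_eq_prod_iota, purePacket_eq_prod_iota, map_prod]
  exact Finset.prod_congr rfl fun i _ => hφ i (x i)

omit [Nonempty I] [∀ i, IsUltrametricDist (k i)] [∀ i, IsUltrametricDist (k' i)] [∀ i, ProperSpace (k' i)] in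
/-- `φ(R_I) ⊆ R'_I` (pure tensors of integers go to pure tensors of integers: the `σ_i` are isometries).
[cite: NeukirchANT1999, Ch. II Thm. (4.8)] [cite: Mochizuki2012, IUTchIV Prop. 1.1 p. 9] -/
theorem map_mem_integerPacket {x : PacketAlgebra p k} (hx : x ∈ integerPacket p k) :
    φ x ∈ integerPacket p k' := by
  have h : integerPacket p k ≤ (integerPacket p k').comap φ.toRingHom := by
    rw [integerPacket]
    refine Subring.closure_le.mpr ?_
    rintro _ ⟨y, hy, rfl⟩
    rw [SetLike.mem_coe, Subring.mem_comap]
    refine Subring.subset_closure ⟨fun i => σ i (y i), fun i => ?_, ?_⟩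
    · rw [norm_map_algHom]; exact hy i
    · exact map_purePacket_of_iota p k k' φ σ hφ y
  exact h hx

end Coprojections

omit [DecidableEq I] in
/-- **`φ((R_I)^∼) ⊆ (R'_I)^∼`** for ANY `ℚ_p`-algebra homomorphism of packets (`(R_I)^∼` is the integral closure of
`ℤ_p` in `V`, and integrality is preserved by algebra maps). [cite: Mochizuki2012, IUTchIV Prop. 1.1 p. 9] -/
theorem map_mem_normalizedPacket {x : PacketAlgebra p k} (hx : x ∈ normalizedPacket p k) :
    φ x ∈ normalizedPacket p k' := by
  rw [mem_normalizedPacket_iff_isIntegral] at hx ⊢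
  exact hx.map (φ.restrictScalars ℤ_[p])

/-- **`φ` maps the slot-union into the slot-union of the images**: if `φ(ι_i(g_i)) = ι'_i(g'_i)` for every slot,
then `φ(⋃_i ι_i(g_i)·(R_I)^∼) ⊆ ⋃_i ι'_i(g'_i)·(R'_I)^∼`. [cite: DupuyHilado2025, §4.7] -/
theorem image_slotUnion_subset (g : Π i, k i) (g' : Π i, k' i)
    (hg : ∀ i, φ (iota p k i (g i)) = iota p k' i (g' i)) :
    φ '' (⋃ i, iota p k i (g i) • (normalizedPacket p k : Set (PacketAlgebra p k))) ⊆
      ⋃ i, iota p k' i (g' i) • (normalizedPacket p k' : Set (PacketAlgebra p k')) := by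
  rintro _ ⟨x, hx, rfl⟩
  obtain ⟨i, hxi⟩ := Set.mem_iUnion.mp hx
  obtain ⟨y, hy, rfl⟩ := Set.mem_smul_set.mp hxi
  refine Set.mem_iUnion.mpr ⟨i, Set.mem_smul_set.mpr ⟨φ y, map_mem_normalizedPacket p k k' φ hy, ?_⟩⟩
  rw [smul_eq_mul, smul_eq_mul, map_mul, hg i]

/-! ## §2 Saturation ⇒ the content is non-increasing -/

omit [Fintype I] [DecidableEq I] [Nonempty I] [∀ i, IsUltrametricDist (k i)] [∀ i, ProperSpace (k i)]
  [∀ i, IsUltrametricDist (k' i)] [∀ i, ProperSpace (k' i)] in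
/-- **Saturation transports `p`-power containers back**: if `φ⁻¹(log_p(R'_I^×)) ⊆ log_p(R_I^×)` then
`φ(U) ⊆ p^m·log_p(R'_I^×) ⇒ U ⊆ p^m·log_p(R_I^×)`. [cite: Mochizuki2012, IUTchIV Prop. 1.2 (ii) p. 10] -/
theorem subset_zpow_smul_logPacket_of_image_subset
    (hsat : ∀ x, φ x ∈ (logPacket p k' : Set (PacketAlgebra p k')) → x ∈ (logPacket p k : Set (PacketAlgebra p k)))
    {U : Set (PacketAlgebra p k)} {m : ℤ}
    (h : φ '' U ⊆ ((p : ℚ_[p]) ^ m) • (logPacket p k' : Set (PacketAlgebra p k'))) :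
    U ⊆ ((p : ℚ_[p]) ^ m) • (logPacket p k : Set (PacketAlgebra p k)) := by
  intro x hx
  have hpm : ((p : ℚ_[p]) ^ m) ≠ 0 := zpow_ne_zero m (Nat.cast_ne_zero.mpr (Fact.out : p.Prime).ne_zero)
  obtain ⟨y', hy', hxy⟩ := Set.mem_smul_set.mp (h ⟨x, hx, rfl⟩)
  have hx' : φ (((p : ℚ_[p]) ^ m)⁻¹ • x) = y' := by
    rw [map_smul, ← hxy, smul_smul, inv_mul_cancel₀ hpm, one_smul]
  have hmem := hsat _ (hx' ▸ hy')
  refine Set.mem_smul_set.mpr ⟨_, hmem, ?_⟩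
  rw [smul_smul, mul_inv_cancel₀ hpm, one_smul]

omit [∀ i, IsUltrametricDist (k' i)] [∀ i, ProperSpace (k' i)] in
/-- **The content is NON-INCREASING along `φ` under saturation**: if `U` has content `m` w.r.t. `log_p(R_I^×)`
(`⊆ p^m·Λ`, `⊄ p^{m+1}·Λ`), `U' ⊆ p^{m'}·log_p(R'_I^×)` and `φ(U) ⊆ U'`, then `m' ≤ m`.
[cite: Mochizuki2012, IUTchIV Prop. 1.2 (ii) p. 10] [cite: DupuyHilado2025, §4.9] -/
theorem content_le_content_of_sat
    (hsat : ∀ x, φ x ∈ (logPacket p k' : Set (PacketAlgebra p k')) → x ∈ (logPacket p k : Set (PacketAlgebra p k)))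
    {U : Set (PacketAlgebra p k)} {U' : Set (PacketAlgebra p k')} (hUU' : φ '' U ⊆ U') {m m' : ℤ}
    (hm1 : ¬ U ⊆ ((p : ℚ_[p]) ^ (m + 1)) • (logPacket p k : Set (PacketAlgebra p k)))
    (hm' : U' ⊆ ((p : ℚ_[p]) ^ m') • (logPacket p k' : Set (PacketAlgebra p k'))) : m' ≤ m := by
  have hU : U ⊆ ((p : ℚ_[p]) ^ m') • (logPacket p k : Set (PacketAlgebra p k)) :=
    subset_zpow_smul_logPacket_of_image_subset p k k' φ hsat (hUU'.trans hm')
  by_contra hlt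
  exact hm1 (hU.trans (zpow_smul_logPacket_anti p k (by omega)))

/-! ## §3 The orbit-hull volume along `φ` -/

/-- **Orbit-hull volume along `φ`, up to the hull-of-the-log-shell terms**: for bounded nonzero regions `U ⊆ V`,
`U' ⊆ V'` with `φ(U) ⊆ U'`, under saturation,
`log μ̄(hull(⋃_γ γ·U)) − log μ̄(hull(log_p(R_I^×))) ≤ log μ̄'(hull'(⋃_{γ'} γ'·U')) − log μ̄'(hull'(log_p(R'_I^×)))`
(both sides are `−(content)·log p`). [cite: DupuyHilado2025, §4.9, §4.12] -/
theorem packetLogμ_packetHull_orbit_le_add_of_sat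
    (hsat : ∀ x, φ x ∈ (logPacket p k' : Set (PacketAlgebra p k')) → x ∈ (logPacket p k : Set (PacketAlgebra p k)))
    {U : Set (PacketAlgebra p k)} (hUb : IsPsiBounded p k U) (hU0 : ∃ x ∈ U, x ≠ 0)
    {U' : Set (PacketAlgebra p k')} (hUb' : IsPsiBounded p k' U') (hU0' : ∃ x ∈ U', x ≠ 0)
    (hUU' : φ '' U ⊆ U') :
    packetLogμ p k (packetHull p k (⋃ γ : indTwo p k, γ • U)) -
        packetLogμ p k (packetHull p k (logPacket p k : Set (PacketAlgebra p k))) ≤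
      packetLogμ p k' (packetHull p k' (⋃ γ : indTwo p k', γ • U')) -
        packetLogμ p k' (packetHull p k' (logPacket p k' : Set (PacketAlgebra p k'))) := by
  obtain ⟨m, -, hm1, -, hvol⟩ := exists_packetLogμ_packetHull_orbit_eq p k hUb hU0
  obtain ⟨m', hm', -, -, hvol'⟩ := exists_packetLogμ_packetHull_orbit_eq p k' hUb' hU0'
  have hle : m' ≤ m := content_le_content_of_sat p k k' φ hsat hUU' hm1 hm'
  have hlogp : 0 ≤ Real.log p := Real.log_nonneg (by exact_mod_cast (Fact.out : p.Prime).one_lt.le)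
  have hle' : (m' : ℝ) ≤ m := by exact_mod_cast hle
  rw [hvol, hvol']
  nlinarith

/-- **`log μ̄(hull(log_p(R_I^×))) ≤ log μ̄'(hull'(log_p(R'_I^×)))` along field embeddings**: if there are
`ℚ_p`-algebra maps `σ_i : k_i → k'_i` for every `i`, then (they are isometries mapping `log_p(R_i^×)` into
`log_p(R'_i^×)`, so the largest norm on the log-units does not decrease, and `log μ̄(hull(log_p(R_I^×))) =
Σ_i log‖z_i^max‖`) the hull-of-the-log-shell term is monotone. [cite: Mochizuki2012, IUTchIV Prop. 1.4 (iii) proof p. 14]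
[cite: NeukirchANT1999, Ch. II Thm. (4.8)] -/
theorem packetLogμ_packetHull_logPacket_le_of_algHom (σ : ∀ i, k i →ₐ[ℚ_[p]] k' i) :
    packetLogμ p k (packetHull p k (logPacket p k : Set (PacketAlgebra p k))) ≤
      packetLogμ p k' (packetHull p k' (logPacket p k' : Set (PacketAlgebra p k'))) := by
  obtain ⟨z, hzmem, hz⟩ := exists_family_isMaxOn_logUnits p k
  obtain ⟨z', hzmem', hz'⟩ := exists_family_isMaxOn_logUnits p k'
  rw [packetLogμ_packetHull_logPacket_eq_sum p k hzmem hz, packetLogμ_packetHull_logPacket_eq_sum p k' hzmem' hz']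
  refine Finset.sum_le_sum fun i _ => ?_
  have hσz : σ i (z i) ∈ logUnits (k' i) :=
    image_logUnits_subset p (σ i).toRingHom (norm_map_algHom (σ i)) ⟨z i, hzmem i, rfl⟩
  have hle : ‖z i‖ ≤ ‖z' i‖ := by
    rw [← norm_map_algHom (σ i) (z i)]
    exact hz' i _ hσz
  exact Real.log_le_log (norm_pos_of_isMaxOn_logUnits p (k i) (hz i)) hle

/-- **The orbit-hull volume is NON-DECREASING along `φ` under saturation, given field embeddings on the
factors**: `log μ̄(hull(⋃_γ γ·U)) ≤ log μ̄'(hull'(⋃_{γ'} γ'·U'))` for bounded nonzero `U`, `U'` with `φ(U) ⊆ U'`.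
[cite: DupuyHilado2025, §4.9, §4.12] [cite: Mochizuki2012, IUTchIV Prop. 1.2 (ii) p. 10] -/
theorem packetLogμ_packetHull_orbit_le_of_sat (σ : ∀ i, k i →ₐ[ℚ_[p]] k' i)
    (hsat : ∀ x, φ x ∈ (logPacket p k' : Set (PacketAlgebra p k')) → x ∈ (logPacket p k : Set (PacketAlgebra p k)))
    {U : Set (PacketAlgebra p k)} (hUb : IsPsiBounded p k U) (hU0 : ∃ x ∈ U, x ≠ 0)
    {U' : Set (PacketAlgebra p k')} (hUb' : IsPsiBounded p k' U') (hU0' : ∃ x ∈ U', x ≠ 0)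
    (hUU' : φ '' U ⊆ U') :
    packetLogμ p k (packetHull p k (⋃ γ : indTwo p k, γ • U)) ≤
      packetLogμ p k' (packetHull p k' (⋃ γ : indTwo p k', γ • U')) := by
  have h1 := packetLogμ_packetHull_orbit_le_add_of_sat p k k' φ hsat hUb hU0 hUb' hU0' hUU'
  have h2 := packetLogμ_packetHull_logPacket_le_of_algHom p k k' σ
  linarith

/-- **Item (X) at every prime, reduced to saturation**: for field embeddings `σ_i : k_i → k'_i`, a packet morphism
`φ` with `φ(ι_i(a)) = ι'_i(σ_i a)`, saturated log-shell preimage, and slot elements `g_i ∈ k_i^×`: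
`log μ̄(hull(⋃_γ γ·⋃_i ι_i(g_i)·(R_I)^∼)) ≤ log μ̄'(hull'(⋃_{γ'} γ'·⋃_i ι'_i(σ_i g_i)·(R'_I)^∼))` — the per-summand
comparison of the G1-Θ memo §2 (X) between the small fields `F_{w_a}` and the big fields `K_{v̲_a}` carrying the
SAME Θ-values. [cite: Mochizuki2012, IUTchIV Thm 1.10 proof Step (v) p. 27–28] [cite: DupuyHilado2025, §4.7, §4.12] -/
theorem packetLogμ_packetHull_orbit_slotUnion_le_of_sat (σ : ∀ i, k i →ₐ[ℚ_[p]] k' i)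
    (hφ : ∀ (i : I) (a : k i), φ (iota p k i a) = iota p k' i (σ i a))
    (hsat : ∀ x, φ x ∈ (logPacket p k' : Set (PacketAlgebra p k')) → x ∈ (logPacket p k : Set (PacketAlgebra p k)))
    (g : Π i, k i) (hg : ∀ i, g i ≠ 0) :
    packetLogμ p k (packetHull p k
        (⋃ γ : indTwo p k, γ • ⋃ i, iota p k i (g i) • (normalizedPacket p k : Set (PacketAlgebra p k)))) ≤
      packetLogμ p k' (packetHull p k'
        (⋃ γ : indTwo p k', γ • ⋃ i, iota p k' i (σ i (g i)) •
          (normalizedPacket p k' : Set (PacketAlgebra p k')))) := by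
  obtain ⟨i₀⟩ := (inferInstance : Nonempty I)
  have hg' : ∀ i, σ i (g i) ≠ 0 := fun i => (map_ne_zero (σ i)).mpr (hg i)
  have hmem : ∀ (κ : I → Type) [∀ i, NontriviallyNormedField (κ i)] [∀ i, NormedAlgebra ℚ_[p] (κ i)]
      (h : Π i, κ i) (i : I), iota p κ i (h i) ∈
        ⋃ i, iota p κ i (h i) • (normalizedPacket p κ : Set (PacketAlgebra p κ)) := fun κ _ _ h i =>
    Set.mem_iUnion.mpr ⟨i, Set.mem_smul_set.mpr ⟨1, Subring.one_mem _, by rw [smul_eq_mul, mul_one]⟩⟩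
  refine packetLogμ_packetHull_orbit_le_of_sat p k k' φ σ hsat
    (isPsiBounded_iUnion_iota_smul_normalizedPacket p k g)
    ⟨_, hmem k g i₀, (map_ne_zero (iota p k i₀)).mpr (hg i₀)⟩
    (isPsiBounded_iUnion_iota_smul_normalizedPacket p k' fun i => σ i (g i))
    ⟨_, hmem k' (fun i => σ i (g i)) i₀, (map_ne_zero (iota p k' i₀)).mpr (hg' i₀)⟩
    (image_slotUnion_subset p k k' φ g (fun i => σ i (g i)) fun i => hφ i (g i))

end Literature.IUT.LogVolume

end
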